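import Summits.ValiantsHypothesis.ValiantsHypothesis.Theorems.SymPencilPerFourRowNoLinearFactor
import Summits.ValiantsHypothesis.ValiantsHypothesis.Theorems.SymPencilPerFourOneRowEndgame
import Literature.Computability.AlgebraicComplexity.PerStabilizerMarcusMayProofs
import Literature.LinearAlgebra.Matrix.PermanentSubperm

/-!
# Route `SymPencil` — pencil rigidity of `per_3` and the column support of a pencil stabilising
# `per [e_k; ·]` (tools for the TORIC sub-case of the cell `(13, 3, 0)` of `sdc(per_4)`;
# `--supports` stmt-ValiantsHypothesis-5674, rung currency only, nothing here bears on `VP ≠ VNP`)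

Pure permanent algebra over a field of characteristic `0`.

* `per3_pencil_rigid`: a linear map `Y` of `3 × 3` matrices with
  `per (A + t · Y A) = per A` for all `A, t` is ZERO.  Proof: every `1 + t Y` preserves `per_3`,
  hence is a monomial sandwich (the tree's Marcus–May/Botta theorem
  `MarcusMay.exists_sandwich_of_permanent_eq`), so `(1 + tY) E_{ab}` has a single non-zero entry
  for `t = 1, 2`; this forces `Y E_{ab} ∈ K E_{ab}`, i.e. `Y` is a Hadamard scaling `c`, and then
  `per` of the scaled permutation matrices `Π_a (1 + t c_{a σ a}) = 1` kills `c`.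
* `col_support_of_pencil`: if a linear map `Y` of `3 × 4` matrices satisfies
  `per [e_k; x + t · Y x] = per [e_k; x]` for all `x, t` (`e_k` the coordinate row), then `Y x` is
  supported on the column `k` (the part of `Y` off the column `k` factors through the `3 × 3`
  matrix of the other columns by cofactor independence, and is a rigid pencil there).

Used by the toric sub-case of cell `(13, 3, 0)` (`SymPencilPerFourToricPairs`,
`SymPencilSdcPerFourCellThirteenThreeToric`). [folklore]
-/

noncomputable section

-- single-conjunct layout: Sub = Summit, duplicated namespace component intended
set_option linter.dupNamespace false

namespace Summit.ValiantsHypothesis.ValiantsHypothesis.Theorems.SymPencilPerFourToricStabilizer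

open Matrix
open Literature.Computability.AlgebraicComplexity
open Summit.ValiantsHypothesis.ValiantsHypothesis.Theorems.SymPencilPerFourInnerRankRows
open Summit.ValiantsHypothesis.ValiantsHypothesis.Theorems.SymPencilPerFourRowForms
open Summit.ValiantsHypothesis.ValiantsHypothesis.Theorems.SymPencilPerFourRowNoLinearFactor

variable {K : Type*} [Field K]

/-! ### `3 × 3` permanents along a pencil -/

/-- **Expansion of `per (M + t N)` in `t`** for `3 × 3` matrices: the `t`- and `t²`-coefficients
are the row-replacement sums. [folklore] -/
theorem per3_add_smul (M N : Matrix (Fin 3) (Fin 3) K) (t : K) :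
    (M + t • N).permanent = M.permanent + t * ∑ a, (M.updateRow a (N a)).permanent +
      t ^ 2 * ∑ a, (N.updateRow a (M a)).permanent + t ^ 3 * N.permanent := by
  simp [Matrix.permanent_fin_three_row, Fin.sum_univ_three, Matrix.updateRow_apply]
  ring

/-- **Cofactor independence for `per_3`**: if the row-replacement sum `Σ_a per (A with row a := Z a)`
vanishes for every `A`, then `Z = 0`. [folklore] -/
theorem eq_zero_of_rowReplace_sum (Z : Matrix (Fin 3) (Fin 3) K) [CharZero K]
    (h : ∀ A : Matrix (Fin 3) (Fin 3) K, ∑ a, (A.updateRow a (Z a)).permanent = 0) : Z = 0 := by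
  ext i l
  have key := h (Matrix.of fun p q => if p ≠ i ∧ q ≠ l then (1 : K) else 0)
  simp only [Fin.sum_univ_three, Matrix.permanent_fin_three_row, Matrix.updateRow_apply,
    Matrix.of_apply] at key
  fin_cases i <;> fin_cases l <;>
    · simp at key
      simpa using key

/-- Entries of a monomial sandwich `D P_π X P_ρ L`. [folklore] -/
theorem sandwich_apply {ι : Type*} [Fintype ι] [DecidableEq ι] (d l : ι → K) (π ρ : Equiv.Perm ι)
    (X : Matrix ι ι K) (s c : ι) :
    (diagonal d * π.permMatrix K * X * ρ.permMatrix K * diagonal l) s c =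
      d s * X (π s) (ρ.symm c) * l c := by
  have h1 : diagonal d * π.permMatrix K * X * ρ.permMatrix K * diagonal l =
      diagonal d * ((X.submatrix π id).submatrix id ρ.symm) * diagonal l := by
    rw [Matrix.mul_assoc (diagonal d), PEquiv.toMatrix_toPEquiv_mul, Matrix.mul_assoc (diagonal d),
      PEquiv.mul_toMatrix_toPEquiv]
  rw [h1, Matrix.mul_diagonal, Matrix.diagonal_mul, Matrix.submatrix_apply, Matrix.submatrix_apply]
  rfl

/-- **A linear `per_3`-preserver maps every matrix unit to a matrix with at most one non-zero
entry** (from the Marcus–May/Botta sandwich form). [folklore] -/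
theorem single_support_of_permanent_eq [CharZero K] (T : Matrix (Fin 3) (Fin 3) K →ₗ[K] Matrix (Fin 3) (Fin 3) K)
    (hT : ∀ X, (T X).permanent = X.permanent) (a b : Fin 3) :
    ∃ s₀ c₀ : Fin 3, ∀ s c, (s, c) ≠ (s₀, c₀) → T (Matrix.single a b 1) s c = 0 := by
  obtain ⟨π, ρ, d, l, -, hform⟩ := MarcusMay.exists_sandwich_of_permanent_eq (F := K) two_ne_zero
    (by simp) T hT
  rcases hform with h | h
  · refine ⟨π.symm a, ρ b, fun s c hsc => ?_⟩
    rw [h, sandwich_apply, Matrix.single_apply]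
    split_ifs with hab
    · exfalso
      apply hsc
      rw [hab.1, hab.2, Equiv.symm_apply_apply, Equiv.apply_symm_apply]
    · ring
  · refine ⟨π.symm b, ρ a, fun s c hsc => ?_⟩
    rw [h, sandwich_apply, Matrix.transpose_apply, Matrix.single_apply]
    split_ifs with hab
    · exfalso
      apply hsc
      rw [hab.1, hab.2, Equiv.symm_apply_apply, Equiv.apply_symm_apply]
    · ring

/-- The permanent of a generalised permutation matrix. [folklore] -/
theorem permanent_genPerm (σ : Equiv.Perm (Fin 3)) (f : Fin 3 → K) :
    (Matrix.of fun s c => if c = σ s then f s else 0).permanent = ∏ s, f s := by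
  have hM : (Matrix.of fun s c => if c = σ s then f s else 0) =
      (diagonal f).submatrix id σ.symm := by
    ext s c
    rw [Matrix.of_apply, Matrix.submatrix_apply, Matrix.diagonal_apply, id]
    by_cases h : c = σ s
    · rw [if_pos h, if_pos (by rw [h, Equiv.symm_apply_apply])]
    · rw [if_neg h, if_neg (fun h' => h (by rw [h', Equiv.apply_symm_apply]))]
  rw [hM, Matrix.permanent_permute_rows, Matrix.permanent_diagonal]

/-- **Pencil rigidity of `per_3`**: a linear map `Y` with `per (A + t · Y A) = per A` for all
`A, t` is zero.  See the module docstring. [folklore] -/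
theorem per3_pencil_rigid [CharZero K] (Y : Matrix (Fin 3) (Fin 3) K →ₗ[K] Matrix (Fin 3) (Fin 3) K)
    (h : ∀ (A : Matrix (Fin 3) (Fin 3) K) (t : K), (A + t • Y A).permanent = A.permanent) :
    Y = 0 := by
  -- the preservers `1 + t Y`
  set T : K → (Matrix (Fin 3) (Fin 3) K →ₗ[K] Matrix (Fin 3) (Fin 3) K) :=
    fun t => LinearMap.id + t • Y with hTdef
  have hTap : ∀ t X, T t X = X + t • Y X := fun t X => by
    rw [hTdef, LinearMap.add_apply, LinearMap.smul_apply, LinearMap.id_apply]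
  have hT : ∀ t : K, ∀ X, (T t X).permanent = X.permanent := fun t X => by
    rw [hTap]
    exact h X t
  -- `Y E_{ab}` is supported at `(a, b)`
  have hoff : ∀ a b s c : Fin 3, (s, c) ≠ (a, b) → Y (Matrix.single a b 1) s c = 0 := by
    intro a b s c hne
    by_contra hy
    have key : ∀ t : K, t ≠ 0 → 1 + t * Y (Matrix.single a b 1) a b = 0 := by
      intro t ht
      obtain ⟨s₀, c₀, hsc⟩ := single_support_of_permanent_eq (T t) (hT t) a b
      have e1 : T t (Matrix.single a b 1) s c = t * Y (Matrix.single a b 1) s c := by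
        rw [hTap, Matrix.add_apply, Matrix.smul_apply, smul_eq_mul, Matrix.single_apply,
          if_neg (fun h' => hne (by rw [h'.1, h'.2])), zero_add]
      have hsc0 : (s, c) = (s₀, c₀) := by
        by_contra h'
        have h2 := hsc s c h'
        rw [e1] at h2
        exact (mul_ne_zero ht hy) h2
      have hab : (a, b) ≠ (s₀, c₀) := fun h' => hne (by rw [hsc0, ← h'])
      have e2 := hsc a b hab
      rwa [hTap, Matrix.add_apply, Matrix.smul_apply, smul_eq_mul, Matrix.single_apply_same] at e2
    have h1 := key 1 one_ne_zero
    have h2 := key 2 two_ne_zero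
    have h3 : (1 : K) = 0 := by linear_combination 2 * h1 - h2
    exact one_ne_zero h3
  -- `Y` is a Hadamard scaling
  have hYA : ∀ (A : Matrix (Fin 3) (Fin 3) K) (s c : Fin 3),
      Y A s c = Y (Matrix.single s c 1) s c * A s c := by
    intro A s c
    conv_lhs => rw [Matrix.matrix_eq_sum_single A]
    simp only [map_sum, Matrix.sum_apply]
    rw [Finset.sum_eq_single s, Finset.sum_eq_single c]
    · rw [show Matrix.single s c (A s c) = A s c • Matrix.single s c (1 : K) by
        rw [Matrix.smul_single, smul_eq_mul, mul_one], map_smul, Matrix.smul_apply, smul_eq_mul,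
        mul_comm]
    · intro b _ hb
      rw [show Matrix.single s b (A s b) = A s b • Matrix.single s b (1 : K) by
        rw [Matrix.smul_single, smul_eq_mul, mul_one], map_smul, Matrix.smul_apply, smul_eq_mul,
        hoff s b s c (fun h' => hb (Prod.mk.inj h').2.symm), mul_zero]
    · intro hc; exact absurd (Finset.mem_univ c) hc
    · intro a _ ha
      refine Finset.sum_eq_zero fun b _ => ?_
      rw [show Matrix.single a b (A a b) = A a b • Matrix.single a b (1 : K) by
        rw [Matrix.smul_single, smul_eq_mul, mul_one], map_smul, Matrix.smul_apply, smul_eq_mul,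
        hoff a b s c (fun h' => ha (Prod.mk.inj h').1.symm), mul_zero]
    · intro hs; exact absurd (Finset.mem_univ s) hs
  -- the scaling constants vanish: test on scaled permutation matrices
  have hc : ∀ s c : Fin 3, Y (Matrix.single s c 1) s c = 0 := by
    intro s c
    set σ : Equiv.Perm (Fin 3) := Equiv.swap s c with hσ
    have hσs : σ s = c := by rw [hσ, Equiv.swap_apply_left]
    set cc : Fin 3 → K := fun a => Y (Matrix.single a (σ a) 1) a (σ a) with hcc
    set P : Matrix (Fin 3) (Fin 3) K := Matrix.of fun a q => if q = σ a then (1 : K) else 0 with hP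
    have hPt : ∀ t : K, P + t • Y P = Matrix.of fun a q => if q = σ a then 1 + t * cc a else 0 := by
      intro t
      ext a q
      rw [Matrix.add_apply, Matrix.smul_apply, smul_eq_mul, hYA, hP, Matrix.of_apply,
        Matrix.of_apply]
      by_cases hq : q = σ a
      · rw [if_pos hq, if_pos hq, hq]
        ring
      · rw [if_neg hq, if_neg hq]
        ring
    have hprod : ∀ t : K, (1 + t * cc 0) * (1 + t * cc 1) * (1 + t * cc 2) = 1 := by
      intro t
      have h1 := h P t
      rw [hPt, permanent_genPerm, hP, permanent_genPerm, Fin.prod_univ_three,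
        Fin.prod_univ_three] at h1
      simpa using h1
    have hcubic : ∀ t : K, 0 + (cc 0 + cc 1 + cc 2) * t +
        (cc 0 * cc 1 + cc 0 * cc 2 + cc 1 * cc 2) * t ^ 2 + (cc 0 * cc 1 * cc 2) * t ^ 3 = 0 := by
      intro t
      linear_combination hprod t
    obtain ⟨-, e1, e2, e3⟩ := cubic_coeffs_eq_zero _ _ _ _ hcubic
    have hcs : cc s = 0 := by
      have key : ∀ x : K, ∏ b : Fin 3, (x - cc b) = x ^ 3 := by
        intro x
        rw [Fin.prod_univ_three]
        linear_combination (-(x ^ 2)) * e1 + x * e2 - e3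
      have h3 : cc s ^ 3 = 0 := by
        rw [← key]
        exact Finset.prod_eq_zero (Finset.mem_univ s) (sub_self _)
      exact pow_eq_zero_iff (n := 3) (by norm_num) |>.1 h3
    rw [hcc] at hcs
    simp only [hσs] at hcs
    exact hcs
  -- conclusion
  apply LinearMap.ext
  intro A
  ext s c
  rw [hYA, hc, zero_mul, LinearMap.zero_apply, Matrix.zero_apply]

/-! ### The column support of a pencil stabilising `per [e_k; ·]` -/

/-- The `3 × 3` matrix of a `3 × 4` matrix off the column `k`, and the permanent with a
coordinate first row: `per [e_k; y] = per (y off column k)`. [folklore] -/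
theorem permanent_rows_single_eq (k : Fin 4) (y : Fin 3 → Fin 4 → K) :
    (Matrix.of ![(Pi.single k 1 : Fin 4 → K), y 0, y 1, y 2]).permanent =
      (Matrix.of fun a b => y a (k.succAbove b) : Matrix (Fin 3) (Fin 3) K).permanent := by
  rw [permanent_of_rows, Matrix.permanent_fin_three_row]
  fin_cases k <;> simp [Fin.succAbove, Matrix.of_apply]

/-- **Column support.**  If `per [e_k; x + t · Y x] = per [e_k; x]` for all `3 × 4` matrices `x`
and all `t`, then `Y x` is supported on the column `k`. See the module docstring. [folklore] -/
theorem col_support_of_pencil [CharZero K] (k : Fin 4)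
    (Y : (Fin 3 → Fin 4 → K) →ₗ[K] (Fin 3 → Fin 4 → K))
    (h : ∀ (x : Fin 3 → Fin 4 → K) (t : K),
      (Matrix.of ![(Pi.single k 1 : Fin 4 → K), (x + t • Y x) 0, (x + t • Y x) 1,
        (x + t • Y x) 2]).permanent =
      (Matrix.of ![(Pi.single k 1 : Fin 4 → K), x 0, x 1, x 2]).permanent) :
    ∀ (x : Fin 3 → Fin 4 → K) (a : Fin 3) (m : Fin 4), m ≠ k → Y x a m = 0 := by
  classical
  -- the projection `A` off the column `k` and the embedding `ι` of `3 × 3` matrices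
  let A : (Fin 3 → Fin 4 → K) →ₗ[K] Matrix (Fin 3) (Fin 3) K :=
    { toFun := fun x => Matrix.of fun a b => x a (k.succAbove b)
      map_add' := fun x y => by ext a b; rfl
      map_smul' := fun c x => by ext a b; rfl }
  have hA : ∀ x a b, A x a b = x a (k.succAbove b) := fun _ _ _ => rfl
  let σ := finSuccAboveEquiv k
  have hσ : ∀ b (hb : k.succAbove b ≠ k), σ.symm ⟨k.succAbove b, hb⟩ = b := fun b hb => by
    rw [Equiv.symm_apply_eq]; exact Subtype.ext (finSuccAboveEquiv_apply k b ▸ rfl)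
  let ι : Matrix (Fin 3) (Fin 3) K →ₗ[K] (Fin 3 → Fin 4 → K) :=
    { toFun := fun M a m => if hm : m = k then 0 else M a (σ.symm ⟨m, hm⟩)
      map_add' := fun M N => by
        funext a m; simp only [Pi.add_apply]; split_ifs <;> simp
      map_smul' := fun c M => by
        funext a m; simp only [Pi.smul_apply, smul_eq_mul, RingHom.id_apply]; split_ifs <;> simp }
  have hιk : ∀ M a, ι M a k = 0 := fun M a => by
    show (if hm : k = k then (0 : K) else _) = 0
    rw [dif_pos rfl]
  have hιb : ∀ M a b, ι M a (k.succAbove b) = M a b := fun M a b => by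
    have hne : k.succAbove b ≠ k := Fin.succAbove_ne k b
    show (if hm : k.succAbove b = k then (0 : K) else M a (σ.symm ⟨k.succAbove b, hm⟩)) = M a b
    rw [dif_neg hne, hσ b hne]
  have hAι : ∀ M, A (ι M) = M := fun M => by
    ext a b; rw [hA, hιb]
  have hAker : ∀ x, A (x - ι (A x)) = 0 := fun x => by
    ext a b; rw [map_sub, hAι, sub_self]
  -- the pencil identity on `3 × 3` matrices
  have hper : ∀ (x : Fin 3 → Fin 4 → K) (t : K),
      (A x + t • A (Y x)).permanent = (A x).permanent := by
    intro x t
    have h1 := h x t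
    rw [permanent_rows_single_eq, permanent_rows_single_eq] at h1
    have e : A x + t • A (Y x) = A (x + t • Y x) := by rw [map_add, map_smul]
    rw [e]
    exact h1
  -- the `t`-coefficient: row-replacement sums vanish
  have hD : ∀ x : Fin 3 → Fin 4 → K, ∑ a, ((A x).updateRow a (A (Y x) a)).permanent = 0 := by
    intro x
    have hcubic : ∀ t : K, 0 + (∑ a, ((A x).updateRow a (A (Y x) a)).permanent) * t +
        (∑ a, ((A (Y x)).updateRow a (A x a)).permanent) * t ^ 2 +
        (A (Y x)).permanent * t ^ 3 = 0 := by
      intro t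
      have h1 := hper x t
      rw [per3_add_smul] at h1
      linear_combination h1
    exact (cubic_coeffs_eq_zero _ _ _ _ hcubic).2.1
  -- (1) the part of `Y` off the column `k` kills the column-`k` matrices
  have hYker : ∀ x₀ : Fin 3 → Fin 4 → K, A x₀ = 0 → A (Y x₀) = 0 := by
    intro x₀ hx₀
    refine eq_zero_of_rowReplace_sum _ fun M => ?_
    have h1 := hD (ι M + x₀)
    have h2 := hD (ι M)
    rw [map_add, hx₀, add_zero, map_add, map_add, hAι] at h1
    rw [hAι] at h2
    have hsplit : ∀ (P Q : Matrix (Fin 3) (Fin 3) K) (a : Fin 3),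
        (M.updateRow a ((P + Q) a)).permanent =
          (M.updateRow a (P a)).permanent + (M.updateRow a (Q a)).permanent := by
      intro P Q a
      have e : (P + Q) a = P a + Q a := rfl
      rw [e]
      fin_cases a <;>
        · simp [Matrix.permanent_fin_three_row, Matrix.updateRow_apply]
          ring
    simp only [hsplit, Finset.sum_add_distrib, h2, zero_add] at h1
    exact h1
  -- (2) the induced pencil on `3 × 3` matrices is rigid
  have hY' : A ∘ₗ Y ∘ₗ ι = 0 := by
    refine per3_pencil_rigid (A ∘ₗ Y ∘ₗ ι) fun M t => ?_
    have h1 := hper (ι M) t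
    rw [hAι] at h1
    exact h1
  -- (3) conclusion
  intro x a m hm
  obtain ⟨b, rfl⟩ := Fin.exists_succAbove_eq hm
  have hx : A (Y x) = 0 := by
    have e : x = ι (A x) + (x - ι (A x)) := by abel
    rw [e, map_add, map_add, hYker _ (hAker x), add_zero]
    exact LinearMap.congr_fun hY' (A x)
  have h1 := congr_fun (congr_fun hx a) b
  rwa [hA, Matrix.zero_apply] at h1

end Summit.ValiantsHypothesis.ValiantsHypothesis.Theorems.SymPencilPerFourToricStabilizer

end
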